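import Summits.CriticalPhenomena.CardyFormulaZ2.Theorems.CardyUniqueLimitCardyRigidityDefs
import Literature.Probability.RandomPlanarGeometry.LoewnerAdapted

/-!
# Adaptedness of the mark flows, the level time and the stopped modulus (line `crossing-martingale`, crux `CardyRigidity`)

Measurability layer of the far-field MOMENT engine (stubs `stub_betaPinning` /
`stub_kernelAffineBeta`, crux `CardyRigidity`, stmt-CriticalPhenomena-0746; vocabulary of
`Theorems/CardyUniqueLimitCardyRigidityDefs.lean`).  For a driving process `W` with continuous
paths, `W 0 = 0`, strongly adapted to a filtration `𝓕`:

* `adapted_markFlow` — the frozen real Loewner flow of every mark `y > 0` is `𝓕`-adapted (the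
  tree's `Loewner.measurable_realFlowTrunc`: the flow is a measurable functional of the path up to
  the present);
* `isStoppingTime_levelTime` — the level time of admissible data is an `𝓕`-stopping time (exit
  times of continuous adapted processes, `Process.isStoppingTime_exitTime`);
* `stronglyMeasurable_etaProc_stopped` — the modulus at the stopped clock `t ∧ levelTime` is
  `𝓕 t`-strongly measurable, hence measurable (`measurable_etaProc_stopped`);
* `integral_crossingObs_eq` — the EXACT identity of the line: under the crossing-martingale
  property, `∫ crossingObs f W x m M d t ∂μ = f (cardyEta (x 0) (x 1) (x 2))` for every `t`
  (martingale expectation between times `0 ≤ t`; the observable starts at the deterministic value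
  `f(η(x))`).
-/

noncomputable section

open MeasureTheory Filter Set Topology
open scoped NNReal ENNReal
open Literature.Probability.RandomPlanarGeometry
open Literature.Probability.Process (exitTime coe_untopA_min_le)

namespace Summit.CriticalPhenomena.CardyFormulaZ2.Cruxes.CardyRigidity.CrossingMartingale

namespace FarField

variable {Ω : Type*} {mΩ : MeasurableSpace Ω} {W : Ω → ℝ≥0 → ℝ} {𝓕 : Filtration ℝ≥0 mΩ}
  {x : Fin 3 → ℝ} {m M d : ℝ}

/-- **The frozen flow of a positive mark is adapted** to any filtration to which the driving
process (continuous paths, `W 0 = 0`) is strongly adapted. [cite: Lawler2005, Ch. 4 §4.1] -/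
theorem adapted_markFlow (hWad : StronglyAdapted 𝓕 (fun t ω ↦ W ω t)) (hWc : ∀ ω, Continuous (W ω))
    (hW0 : ∀ ω, W ω 0 = 0) {y : ℝ} (hy : 0 < y) : Adapted 𝓕 (markFlow W y) := by
  intro t
  have hmeas : ∀ s, s ≤ t → Measurable[𝓕 t] fun ω ↦ W ω s := fun s hs ↦
    ((hWad s).measurable).mono (𝓕.mono hs) le_rfl
  have h := Loewner.measurable_realFlowTrunc (mΩ := 𝓕 t) (W := W) (t := t) hWc hW0 hmeas hy
  have hfun : markFlow W y t = fun ω ↦ if (t : WithTop ℝ≥0) < Loewner.swallowingTime (W ω) y then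
      (Loewner.map (W ω) t y).re - W ω t else 0 := by
    funext ω
    rfl
  rw [hfun]
  exact h

/-- The frozen flows have continuous paths (positive marks, `W 0 = 0`). [folklore] -/
theorem continuous_markFlow (hWc : ∀ ω, Continuous (W ω)) (hW0 : ∀ ω, W ω 0 = 0) {y : ℝ}
    (hy : 0 < y) (ω : Ω) : Continuous fun t ↦ markFlow W y t ω :=
  Loewner.continuous_realFlowStop_of_ne (hWc ω) (by rw [hW0 ω]; exact hy.ne')

/-- **The level time is a stopping time.** [folklore] -/
theorem isStoppingTime_levelTime (hWad : StronglyAdapted 𝓕 (fun t ω ↦ W ω t))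
    (hWc : ∀ ω, Continuous (W ω)) (hW0 : ∀ ω, W ω 0 = 0) (h : AdmissibleLevels x m M d) :
    IsStoppingTime 𝓕 (levelTime W x m M d) := by
  have hxpos : ∀ i, 0 < x i := fun i ↦ h.pos.trans_le (h.strictMono.monotone (Fin.zero_le i))
  have had : ∀ i, Adapted 𝓕 (markFlow W (x i)) := fun i ↦ adapted_markFlow hWad hWc hW0 (hxpos i)
  have hc : ∀ i ω, Continuous fun t ↦ markFlow W (x i) t ω := fun i ω ↦
    continuous_markFlow hWc hW0 (hxpos i) ω
  have h0 : IsStoppingTime 𝓕 (exitTime (markFlow W (x 0)) m M) :=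
    Literature.Probability.Process.isStoppingTime_exitTime (had 0) (hc 0)
  have h1 : IsStoppingTime 𝓕
      (exitTime (fun t ω ↦ markFlow W (x 1) t ω - markFlow W (x 0) t ω) d (x 2 - x 0 + 1)) :=
    Literature.Probability.Process.isStoppingTime_exitTime (fun t ↦ (had 1 t).sub (had 0 t))
      (fun ω ↦ (hc 1 ω).sub (hc 0 ω))
  have h2 : IsStoppingTime 𝓕
      (exitTime (fun t ω ↦ markFlow W (x 2) t ω - markFlow W (x 1) t ω) d (x 2 - x 0 + 1)) :=
    Literature.Probability.Process.isStoppingTime_exitTime (fun t ↦ (had 2 t).sub (had 1 t))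
      (fun ω ↦ (hc 2 ω).sub (hc 1 ω))
  exact h0.min (h1.min h2)

/-- **The mark flows stopped at the level time are strongly adapted.** [folklore] -/
theorem stronglyAdapted_stoppedProcess_markFlow (hWad : StronglyAdapted 𝓕 (fun t ω ↦ W ω t))
    (hWc : ∀ ω, Continuous (W ω)) (hW0 : ∀ ω, W ω 0 = 0) (h : AdmissibleLevels x m M d)
    (i : Fin 3) : StronglyAdapted 𝓕 (stoppedProcess (markFlow W (x i)) (levelTime W x m M d)) := by
  have hxpos : 0 < x i := h.pos.trans_le (h.strictMono.monotone (Fin.zero_le i))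
  have had : Adapted 𝓕 (markFlow W (x i)) := adapted_markFlow hWad hWc hW0 hxpos
  exact (StronglyAdapted.isStronglyProgressive_of_continuous (fun t ↦ (had t).stronglyMeasurable)
    (fun ω ↦ continuous_markFlow hWc hW0 hxpos ω)).stronglyAdapted_stoppedProcess
    (isStoppingTime_levelTime hWad hWc hW0 h)

/-- **The modulus at the stopped clock is strongly measurable** with respect to `𝓕 t`.
[folklore] -/
theorem stronglyMeasurable_etaProc_stopped (hWad : StronglyAdapted 𝓕 (fun t ω ↦ W ω t))
    (hWc : ∀ ω, Continuous (W ω)) (hW0 : ∀ ω, W ω 0 = 0) (h : AdmissibleLevels x m M d)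
    (t : ℝ≥0) :
    StronglyMeasurable[𝓕 t] fun ω ↦
      etaProc W x (min (t : WithTop ℝ≥0) (levelTime W x m M d ω)).untopA ω := by
  have hs := fun i ↦ stronglyAdapted_stoppedProcess_markFlow hWad hWc hW0 h i t
  have hfun : (fun ω ↦ etaProc W x (min (t : WithTop ℝ≥0) (levelTime W x m M d ω)).untopA ω) =
      fun ω ↦ cardyEta (stoppedProcess (markFlow W (x 0)) (levelTime W x m M d) t ω)
        (stoppedProcess (markFlow W (x 1)) (levelTime W x m M d) t ω)
        (stoppedProcess (markFlow W (x 2)) (levelTime W x m M d) t ω) := by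
    funext ω
    rfl
  rw [hfun]
  simp only [cardyEta]
  exact ((hs 0).mul ((hs 2).sub (hs 1))).div ((hs 1).mul ((hs 2).sub (hs 0)))

/-- The modulus at the stopped clock is measurable (ambient σ-algebra). [folklore] -/
theorem measurable_etaProc_stopped (hWad : StronglyAdapted 𝓕 (fun t ω ↦ W ω t))
    (hWc : ∀ ω, Continuous (W ω)) (hW0 : ∀ ω, W ω 0 = 0) (h : AdmissibleLevels x m M d)
    (t : ℝ≥0) :
    Measurable fun ω ↦ etaProc W x (min (t : WithTop ℝ≥0) (levelTime W x m M d ω)).untopA ω :=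
  ((stronglyMeasurable_etaProc_stopped hWad hWc hW0 h t).measurable).mono (𝓕.le t) le_rfl

/-- The crossing observable at time `0` is the deterministic value `f (η(x))`. [folklore] -/
theorem crossingObs_zero (hWc : ∀ ω, Continuous (W ω)) (hW0 : ∀ ω, W ω 0 = 0)
    (h : AdmissibleLevels x m M d) (f : ℝ → ℝ) (ω : Ω) :
    crossingObs f W x m M d 0 ω = f (cardyEta (x 0) (x 1) (x 2)) := by
  have hxpos : ∀ i, 0 < x i := fun i ↦ h.pos.trans_le (h.strictMono.monotone (Fin.zero_le i))
  have hne : ∀ i, x i ≠ W ω 0 := fun i ↦ by rw [hW0 ω]; exact (hxpos i).ne'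
  have hzero : ∀ i, markFlow W (x i) 0 ω = x i := by
    intro i
    show Loewner.realFlowStop (W ω) (x i) 0 = x i
    rw [Loewner.realFlowStop_zero_of_ne (hWc ω) (hne i), hW0 ω, sub_zero]
  have hmin : (min ((0 : ℝ≥0) : WithTop ℝ≥0) (levelTime W x m M d ω)).untopA = 0 := by
    rw [min_eq_left (by exact bot_le)]
    rfl
  show f (etaProc W x (min ((0 : ℝ≥0) : WithTop ℝ≥0) (levelTime W x m M d ω)).untopA ω) = _
  rw [hmin]
  simp only [etaProc, hzero]

/-- **The exact identity of the line.**  Under the crossing-martingale property, the expectation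
of the level-stopped crossing observable at any time equals its deterministic time-`0` value
`f (η(x))` (probability space). [folklore] -/
theorem integral_crossingObs_eq {μ : Measure Ω} [IsProbabilityMeasure μ] {f : ℝ → ℝ}
    (hWc : ∀ ω, Continuous (W ω)) (hW0 : ∀ ω, W ω 0 = 0)
    (hmart : IsCrossingMartingaleFamily f μ W 𝓕) (h : AdmissibleLevels x m M d) (t : ℝ≥0) :
    ∫ ω, crossingObs f W x m M d t ω ∂μ = f (cardyEta (x 0) (x 1) (x 2)) := by
  have hM := hmart x m M d h
  have h0t := hM.setIntegral_eq (zero_le (a := t)) (MeasurableSet.univ : MeasurableSet[𝓕 0] univ)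
  simp only [Measure.restrict_univ] at h0t
  rw [← h0t]
  have : (fun ω ↦ crossingObs f W x m M d 0 ω) = fun _ ↦ f (cardyEta (x 0) (x 1) (x 2)) := by
    funext ω; exact crossingObs_zero hWc hW0 h f ω
  rw [this, integral_const, smul_eq_mul, probReal_univ, one_mul]

/-- **Registered form** (glue sub-goal `farField_integral_crossingObs_eq` of stmt-CriticalPhenomena-0746):
the exact identity `E[crossingObs_t] = f(η(x))` under the crossing-martingale property. [folklore] -/
theorem farField_integral_crossingObs_eq : ∀ {Ω : Type*} {mΩ : MeasurableSpace Ω} {W : Ω → ℝ≥0 → ℝ} {𝓕 : MeasureTheory.Filtration ℝ≥0 mΩ} {x : Fin 3 → ℝ} {m M d : ℝ} {μ : MeasureTheory.Measure Ω} [MeasureTheory.IsProbabilityMeasure μ] {f : ℝ → ℝ}, (∀ ω, Continuous (W ω)) → (∀ ω, W ω 0 = 0) → IsCrossingMartingaleFamily f μ W 𝓕 → AdmissibleLevels x m M d → ∀ t : ℝ≥0, ∫ ω, crossingObs f W x m M d t ω ∂μ = f (cardyEta (x 0) (x 1) (x 2)) :=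
  fun hWc hW0 hmart h t ↦ integral_crossingObs_eq hWc hW0 hmart h t

end FarField

end Summit.CriticalPhenomena.CardyFormulaZ2.Cruxes.CardyRigidity.CrossingMartingale

end
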